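import Summits.CriticalPhenomena.PercolationContinuityZ3.Theorems.PercNearOneGluingNoHeavyLowerTailSahiCombTriWGenSymm

/-!
# The token count of `TRI_W(a)` for every `a`: `triW = SUPPLY − CROSS − NET`, with the net degree `N(f,g) = #(f ∩ g) − #{x ∈ f : xᶜ ∈ g} ≥ 0`

Support file of the one-cut programme (crux `NoHeavyLowerTail`, stmt-CriticalPhenomena-4575; TRI lane of cell `prim-masterthm`, seat P5 gen 30;
memo `FROM-prim-masterthm-p5-g30-STRATA.md` §1; gen 29 memo §9b).  The Hall / rank route to `FiveUpSet.TriWIneq` (gen 28–29: `…TriWDiamondStratum`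
at `a = 2`) rests on writing the one-cube triangle functional as "two copies of every level minus demand tokens".  For a GENERAL index cube this reads

  `triW P F G = 2·Σ_x #(P ∩ F x ∩ G x) − Σ_x #(P ∩ refl (F x) ∩ G xᶜ) − Σ_x #(P ∩ F x ∩ refl (G xᶜ)) − Σ_{d ∈ P} N(idxSet F dᶜ, idxSet G dᶜ)`

(`triW_eq_token_count`), where `idxSet F e = {x | e ∈ F x}` is the index pattern of a point (`…SahiCombTriWShell`) and the NET DEGREE of a pair of
index sets is `N(f,g) = #(f ∩ g) − #(f ∩ refl g)` (`= #(f ∩ g) − #{x ∈ f : xᶜ ∈ g}`; written out, no new definition).  For monotone families the patterns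
are up-sets of the index cube and `N ≥ 0` is Harris–Kleitman there (`net_idxSet_nonneg`): the netted demand is a genuine (non-negative) multiset of
tokens, `N(f,g)` at each point `d ∈ P` with complement patterns `(f,g)`.  So `TriWIneq` at any `a` is the statement that the cross tokens
`(d ∈ G xᶜ, dᶜ ∈ F x)`, `(d ∈ F x, dᶜ ∈ G xᶜ)` and the net tokens fit into two copies of the levels `P ∩ F x ∩ G x` — the form in which every kernel-lemma
design (gen 29's P2 at `a = 2`; the `a = 3` designs of the memo) certifies it.

* `FiveUpSet.net_idxSet_nonneg` — `#(idxSet F e ∩ refl (idxSet G e)) ≤ #(idxSet F e ∩ idxSet G e)` for monotone `F, G`;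
* `FiveUpSet.sum_card_inter_refl_refl`, `FiveUpSet.sum_card_inter_refl_refl_compl` — the two double counts behind the net term;
* **`FiveUpSet.triW_eq_token_count`** — the identity, all `P, F, G` (no hypotheses).
HONEST LABEL: identities and one Harris–Kleitman corollary (std axioms); `TriWIneq` itself stays OPEN for `a ≥ 3`. [this work]
-/

namespace Summit.CriticalPhenomena.PercolationContinuityZ3.Theorems

namespace FiveUpSet

open Finset

variable {β γ : Type} [DecidableEq β] [Fintype β] [DecidableEq γ] [Fintype γ]

omit [Fintype γ] in
/-- Harris–Kleitman on the index cube for the complement patterns of monotone families: `#(f ∩ refl g) ≤ #(f ∩ g)` with `f = idxSet F e`, `g = idxSet G e`,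
i.e. the net degree `N(f,g) = #(f ∩ g) − #{x ∈ f : xᶜ ∈ g}` is non-negative. [folklore] -/
theorem net_idxSet_nonneg (F G : Finset β → Finset (Finset γ)) (hFm : Monotone F) (hGm : Monotone G) (e : Finset γ) :
    0 ≤ ((idxSet F e ∩ idxSet G e).card : ℤ) - (idxSet F e ∩ refl (idxSet G e)).card := by
  have h := card_inter_refl_le (isUpperSet_idxSet' hFm e) (isUpperSet_idxSet' hGm e)
  omega

/-- Double count: `Σ_x #(P ∩ refl (F x) ∩ refl (G x)) = Σ_{d ∈ P} #(idxSet F dᶜ ∩ idxSet G dᶜ)`. [this work] -/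
theorem sum_card_inter_refl_refl (P : Finset (Finset γ)) (F G : Finset β → Finset (Finset γ)) :
    ∑ x : Finset β, ((P ∩ refl (F x) ∩ refl (G x)).card : ℤ) = ∑ d ∈ P, ((idxSet F dᶜ ∩ idxSet G dᶜ).card : ℤ) := by
  have h1 : ∀ x : Finset β, ((P ∩ refl (F x) ∩ refl (G x)).card : ℤ) = ∑ d ∈ P, (if dᶜ ∈ F x ∧ dᶜ ∈ G x then (1 : ℤ) else 0) := by
    intro x
    rw [Finset.sum_boole]
    congr 1
    congr 1
    ext d
    simp only [mem_inter, mem_filter, mem_refl, and_assoc]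
  have h2 : ∀ d : Finset γ, ((idxSet F dᶜ ∩ idxSet G dᶜ).card : ℤ) = ∑ x : Finset β, (if dᶜ ∈ F x ∧ dᶜ ∈ G x then (1 : ℤ) else 0) := by
    intro d
    rw [Finset.sum_boole]
    congr 1
    congr 1
    ext x
    simp only [mem_inter, mem_filter, mem_idxSet, mem_univ, true_and]
  simp only [h1, h2]
  exact Finset.sum_comm

/-- Double count: `Σ_x #(P ∩ refl (F x) ∩ refl (G xᶜ)) = Σ_{d ∈ P} #(idxSet F dᶜ ∩ refl (idxSet G dᶜ))`. [this work] -/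
theorem sum_card_inter_refl_refl_compl (P : Finset (Finset γ)) (F G : Finset β → Finset (Finset γ)) :
    ∑ x : Finset β, ((P ∩ refl (F x) ∩ refl (G xᶜ)).card : ℤ) = ∑ d ∈ P, ((idxSet F dᶜ ∩ refl (idxSet G dᶜ)).card : ℤ) := by
  have h1 : ∀ x : Finset β, ((P ∩ refl (F x) ∩ refl (G xᶜ)).card : ℤ) = ∑ d ∈ P, (if dᶜ ∈ F x ∧ dᶜ ∈ G xᶜ then (1 : ℤ) else 0) := by
    intro x
    rw [Finset.sum_boole]
    congr 1
    congr 1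
    ext d
    simp only [mem_inter, mem_filter, mem_refl, and_assoc]
  have h2 : ∀ d : Finset γ, ((idxSet F dᶜ ∩ refl (idxSet G dᶜ)).card : ℤ) = ∑ x : Finset β, (if dᶜ ∈ F x ∧ dᶜ ∈ G xᶜ then (1 : ℤ) else 0) := by
    intro d
    rw [Finset.sum_boole]
    congr 1
    congr 1
    ext x
    simp only [mem_inter, mem_filter, mem_idxSet, mem_refl, mem_univ, true_and]
  simp only [h1, h2]
  exact Finset.sum_comm

/-- **The token count of `TRI_W(a)`** (every index cube, no hypotheses):
`triW P F G = 2·Σ_x #(P∩F x∩G x) − Σ_x #(P∩refl (F x)∩G xᶜ) − Σ_x #(P∩F x∩refl (G xᶜ)) − Σ_{d∈P} [#(f_d ∩ g_d) − #(f_d ∩ refl g_d)]`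
with the complement patterns `f_d = idxSet F dᶜ`, `g_d = idxSet G dᶜ`. [this work] -/
theorem triW_eq_token_count (P : Finset (Finset γ)) (F G : Finset β → Finset (Finset γ)) :
    triW P F G = 2 * ∑ x : Finset β, ((P ∩ F x ∩ G x).card : ℤ)
      - ∑ x : Finset β, ((P ∩ refl (F x) ∩ G xᶜ).card : ℤ)
      - ∑ x : Finset β, ((P ∩ F x ∩ refl (G xᶜ)).card : ℤ)
      - ∑ d ∈ P, (((idxSet F dᶜ ∩ idxSet G dᶜ).card : ℤ) - (idxSet F dᶜ ∩ refl (idxSet G dᶜ)).card) := by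
  have hnet : ∑ d ∈ P, (((idxSet F dᶜ ∩ idxSet G dᶜ).card : ℤ) - (idxSet F dᶜ ∩ refl (idxSet G dᶜ)).card)
      = ∑ x : Finset β, ((P ∩ refl (F x) ∩ refl (G x)).card : ℤ) - ∑ x : Finset β, ((P ∩ refl (F x) ∩ refl (G xᶜ)).card : ℤ) := by
    rw [sum_card_inter_refl_refl, sum_card_inter_refl_refl_compl, ← Finset.sum_sub_distrib]
  rw [hnet]
  unfold triW triWTerm
  simp only [Finset.sum_sub_distrib, Finset.sum_add_distrib, Finset.mul_sum]
  ring

end FiveUpSet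

end Summit.CriticalPhenomena.PercolationContinuityZ3.Theorems
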